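import Mathlib
import Summits.ValiantsHypothesis.ValiantsHypothesis.Theorems.BinomialElusiveBinomialCandidateLowDegreeVanishing

/-!
# Crux `BinomialElusive.BinomialCandidate` (stmt-ValiantsHypothesis-7392), line `registered` —
# helper `lowDegreeVanishing_deg`: parametric uniqueness at degree `≤ D₀`

The degree-`D₀` generalisation of `stub_lowDegreeVanishing` / `lowDegreeVanishing_zero` (those are
the case `D₀ = 2`).  Data: a degree bound `D₀`, exponents `a b : Fin m → ℕ`, `N > 0`, the binomials
`T_i := t^{N a_i} + t^{N b_i} ∈ ℂ((t))`,
(P1) no nonzero integer relation `Σ_i (u_i a_i + v_i b_i) = 0` of length `Σ_i (|u_i| + |v_i|) ≤ 2 D₀`,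
(P2) a modulus `M'` with `a_i ≡ b_i ≡ 1 (mod M')` and `D₀ e < M' e'` for all exponents `e, e'`.
Claim (`lowDegreeVanishing_deg`): if a polynomial `ψ` in the variables `X_i`, without constant term,
satisfies `ψ(T) ≡ 0 (mod t^G)` with `G` beyond `D₀` times every `N a_i`, `N b_i`, then every
coefficient of `ψ` of degree `≤ D₀` vanishes.  This is the uniqueness step of the cycle-2 treatment
of the shallow rank-drop base points in `stub_nonImmersiveIntegral` (Weierstrass eliminants of
multiplicity `≤ D₀`).

Proof (the proof of `stub_lowDegreeVanishing` with `2` replaced by `D₀`).  Expand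
`ψ(T) = Σ_γ c_γ Π_i T_i^{γ_i}` by the binomial theorem (`LowDegreeVanishing.coeff_aeval_binomial`):
the coefficient of `t^g` is the sum of `c_γ Π_i C(γ_i, s_i)` over the pairs `(γ, s)`, `s ≤ γ`, with
`N Σ_i (s_i a_i + (γ_i - s_i) b_i) = g`.  Fix `d ≠ 0` of degree `≤ D₀` and look at the exponent
`e⋆ := N Σ_i d_i a_i ≤ D₀ N a_max < G`.  A pair `(γ, s)` with exponent `e⋆` has
`D₀ |γ| e_min ≤ D₀ Σ_i d_i a_i < |d| M' e_min ≤ D₀ M' e_min`, so `|γ| < M'`; reducing modulo `M'`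
gives `|γ| ≡ |d|`, and `|d| ≤ D₀ < M'`, hence `|γ| = |d|`; then `(s - d, γ - s)` is a relation of
length `≤ |d| + |γ| ≤ 2 D₀`, so by (P1) it is zero: `(γ, s) = (d, d)` (`split_unique`).  Hence the
coefficient of `ψ(T)` at `e⋆` is `c_d`, and it vanishes by hypothesis as `e⋆ < G`.  The degree-`0`
coefficient is the constant term.  Mathlib plus the expansion lemmas of the `D₀ = 2` file
(`LowDegreeVanishing.coeff_aeval_binomial`, `LowDegreeVanishing.exponent_cast`).
-/

-- layout Summits/ValiantsHypothesis/ValiantsHypothesis forces the duplicated namespace component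
set_option linter.dupNamespace false

namespace Summit.ValiantsHypothesis.ValiantsHypothesis.Theorems.BinomialCandidateStubs

open scoped BigOperators
open Finset

namespace LowDegreeVanishingDeg

/-! ## Arithmetic of the exponent data: (P1) at length `2 D₀` and (P2) with factor `D₀` -/

/-- From (P2) with factor `D₀`: a common lower bound `e` of all the exponents with `D₀ a_j < M' e`
and `D₀ b_j < M' e`. -/
theorem exists_lower {m : ℕ} (D₀ : ℕ) (a b : Fin m → ℕ) (M' : ℕ)
    (hlt : ∀ i j, D₀ * a i < M' * a j ∧ D₀ * a i < M' * b j ∧ D₀ * b i < M' * a j ∧ D₀ * b i < M' * b j)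
    (i₀ : Fin m) :
    ∃ e : ℕ, (∀ i, e ≤ a i ∧ e ≤ b i) ∧ ∀ j, D₀ * a j < M' * e ∧ D₀ * b j < M' * e := by
  obtain ⟨i₁, -, hi₁⟩ := exists_min_image univ (fun i => min (a i) (b i)) ⟨i₀, mem_univ _⟩
  refine ⟨min (a i₁) (b i₁), fun i => ⟨(hi₁ i (mem_univ _)).trans (min_le_left _ _),
    (hi₁ i (mem_univ _)).trans (min_le_right _ _)⟩, fun j => ?_⟩
  rcases min_choice (a i₁) (b i₁) with h | h <;> rw [h]
  · exact ⟨(hlt j i₁).1, (hlt j i₁).2.2.1⟩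
  · exact ⟨(hlt j i₁).2.1, (hlt j i₁).2.2.2⟩

/-- **Uniqueness of the low splitting** (degree `≤ D₀`).  Under (P1) at length `2 D₀` and (P2) with
factor `D₀`, if `d ≠ 0` has degree `|d| ≤ D₀` and a splitting `(γ, s)` (`s ≤ γ`) has the exponent
of the all-lower splitting `(d, d)`, i.e. `Σ_i (s_i a_i + (γ_i - s_i) b_i) = Σ_i d_i a_i`, then
`(γ, s) = (d, d)`. -/
theorem split_unique {m : ℕ} (D₀ : ℕ) (a b : Fin m → ℕ) (M' : ℕ)
    (hP1 : ∀ u v : Fin m → ℤ, ∑ i, (|u i| + |v i|) ≤ 2 * (D₀ : ℤ) →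
      ∑ i, (u i * (a i : ℤ) + v i * (b i : ℤ)) = 0 → (u, v) = 0)
    (hmod : ∀ i, a i % M' = 1 ∧ b i % M' = 1)
    (hlt : ∀ i j, D₀ * a i < M' * a j ∧ D₀ * a i < M' * b j ∧ D₀ * b i < M' * a j ∧ D₀ * b i < M' * b j)
    (d : Fin m → ℕ) (hdD : ∑ i, d i ≤ D₀) (hd0 : d ≠ 0)
    (γ s : Fin m → ℕ) (hs : ∀ i, s i ≤ γ i)
    (he : ∑ i, (s i * a i + (γ i - s i) * b i) = ∑ i, d i * a i) :
    s = d ∧ γ = d := by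
  -- an index in the support of `d`
  obtain ⟨i₀, hi₀⟩ : ∃ i, d i ≠ 0 := by
    by_contra h
    push Not at h
    exact hd0 (funext h)
  have hM' : D₀ < M' := lt_of_mul_lt_mul_right (hlt i₀ i₀).1 (Nat.zero_le _)
  obtain ⟨e, hle, helt⟩ := exists_lower D₀ a b M' hlt i₀
  -- (a) `|γ| < M'`
  have h1 : (∑ i, γ i) * e ≤ ∑ i, d i * a i := by
    rw [← he, sum_mul]
    refine sum_le_sum fun i _ => ?_
    calc γ i * e = s i * e + (γ i - s i) * e := by rw [← add_mul, Nat.add_sub_of_le (hs i)]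
      _ ≤ s i * a i + (γ i - s i) * b i :=
        add_le_add (Nat.mul_le_mul_left _ (hle i).1) (Nat.mul_le_mul_left _ (hle i).2)
  have h2 : D₀ * ∑ i, d i * a i < D₀ * (M' * e) := by
    calc D₀ * ∑ i, d i * a i = ∑ i, d i * (D₀ * a i) := by
          rw [mul_sum]; exact sum_congr rfl fun i _ => by ring
      _ < ∑ i, d i * (M' * e) :=
          sum_lt_sum (fun i _ => Nat.mul_le_mul_left _ (helt i).1.le)
            ⟨i₀, mem_univ _, mul_lt_mul_of_pos_left (helt i₀).1 (Nat.pos_of_ne_zero hi₀)⟩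
      _ = (∑ i, d i) * (M' * e) := by rw [sum_mul]
      _ ≤ D₀ * (M' * e) := Nat.mul_le_mul_right _ hdD
  have hγM : ∑ i, γ i < M' := by
    have h3 : D₀ * ((∑ i, γ i) * e) < D₀ * (M' * e) := lt_of_le_of_lt (Nat.mul_le_mul_left _ h1) h2
    have h4 : (∑ i, γ i) * e < M' * e := lt_of_mul_lt_mul_left h3 (Nat.zero_le _)
    exact lt_of_mul_lt_mul_right h4 (Nat.zero_le _)
  -- (b) `|γ| = |d|` by reduction modulo `M'`
  have hγd : ∑ i, γ i = ∑ i, d i := by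
    have ha : ∀ i, ((a i : ℕ) : ZMod M') = 1 := fun i => by
      rw [← ZMod.natCast_mod (a i) M', (hmod i).1, Nat.cast_one]
    have hb : ∀ i, ((b i : ℕ) : ZMod M') = 1 := fun i => by
      rw [← ZMod.natCast_mod (b i) M', (hmod i).2, Nat.cast_one]
    have hcast : ((∑ i, (s i * a i + (γ i - s i) * b i) : ℕ) : ZMod M') =
        ((∑ i, d i * a i : ℕ) : ZMod M') := by rw [he]
    push_cast at hcast
    simp only [ha, hb, mul_one] at hcast
    have hγ' : ((∑ i, γ i : ℕ) : ZMod M') = ((∑ i, d i : ℕ) : ZMod M') := by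
      push_cast
      rw [← hcast]
      refine sum_congr rfl fun i _ => ?_
      rw [← Nat.cast_add, Nat.add_sub_of_le (hs i)]
    have := (ZMod.natCast_eq_natCast_iff' _ _ _).1 hγ'
    rwa [Nat.mod_eq_of_lt hγM, Nat.mod_eq_of_lt (hdD.trans_lt hM')] at this
  -- (c) `(s - d, γ - s)` is a relation of length `≤ |d| + |γ| ≤ 2 D₀`
  have key := hP1 (fun i => (s i : ℤ) - d i) (fun i => ((γ i - s i : ℕ) : ℤ)) ?_ ?_
  · simp only [Prod.mk_eq_zero, funext_iff, Pi.zero_apply, sub_eq_zero, Nat.cast_inj,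
      Nat.cast_eq_zero] at key
    obtain ⟨hu, hv⟩ := key
    refine ⟨funext hu, funext fun i => ?_⟩
    have h4 := hv i
    have h5 := hu i
    have h6 := hs i
    omega
  · -- length
    have hterm : ∀ i, |(s i : ℤ) - d i| + |((γ i - s i : ℕ) : ℤ)| ≤ ((d i + γ i : ℕ) : ℤ) := by
      intro i
      have h4 : |(s i : ℤ) - d i| ≤ (s i : ℤ) + d i := abs_le.2 ⟨by omega, by omega⟩
      have h5 : |((γ i - s i : ℕ) : ℤ)| = ((γ i - s i : ℕ) : ℤ) := abs_of_nonneg (by positivity)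
      have h6 := hs i
      rw [h5]
      push_cast
      omega
    calc ∑ i, (|(s i : ℤ) - d i| + |((γ i - s i : ℕ) : ℤ)|)
        ≤ ∑ i, ((d i + γ i : ℕ) : ℤ) := sum_le_sum fun i _ => hterm i
      _ = ((∑ i, d i + ∑ i, γ i : ℕ) : ℤ) := by push_cast; rw [sum_add_distrib]
      _ ≤ 2 * (D₀ : ℤ) := by rw [hγd]; norm_cast; omega
  · -- relation
    have hz : ((∑ i, (s i * a i + (γ i - s i) * b i) : ℕ) : ℤ) = ((∑ i, d i * a i : ℕ) : ℤ) := by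
      rw [he]
    push_cast at hz
    calc ∑ i, (((s i : ℤ) - d i) * (a i : ℤ) + ((γ i - s i : ℕ) : ℤ) * (b i : ℤ))
        = ∑ i, ((s i : ℤ) * a i + ((γ i - s i : ℕ) : ℤ) * b i) - ∑ i, (d i : ℤ) * a i := by
          rw [← sum_sub_distrib]
          exact sum_congr rfl fun i _ => by ring
      _ = 0 := by rw [hz, sub_self]

/-- The special exponent `e⋆ = N Σ_i d_i a_i` (`|d| ≤ D₀`) lies below the precision `G`
(`G > D₀ N a_i` for all `i`). -/
theorem special_lt {m : ℕ} {D₀ : ℕ} {a b : Fin m → ℕ} {N : ℕ} {G : ℤ}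
    (hG : ∀ i, (D₀ : ℤ) * ((N * a i : ℕ) : ℤ) < G ∧ (D₀ : ℤ) * ((N * b i : ℕ) : ℤ) < G)
    {d : Fin m → ℕ} (hdD : ∑ i, d i ≤ D₀) (i₀ : Fin m) :
    ((N * ∑ i, d i * a i : ℕ) : ℤ) < G := by
  obtain ⟨j, -, hj⟩ := exists_max_image univ a ⟨i₀, mem_univ _⟩
  have h1 : ∑ i, d i * a i ≤ D₀ * a j := by
    calc ∑ i, d i * a i ≤ ∑ i, d i * a j :=
          sum_le_sum fun i _ => Nat.mul_le_mul_left _ (hj i (mem_univ _))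
      _ = (∑ i, d i) * a j := by rw [sum_mul]
      _ ≤ D₀ * a j := Nat.mul_le_mul_right _ hdD
  have h2 : N * ∑ i, d i * a i ≤ D₀ * (N * a j) := by
    calc N * ∑ i, d i * a i ≤ N * (D₀ * a j) := Nat.mul_le_mul_left _ h1
      _ = D₀ * (N * a j) := by ring
  calc ((N * ∑ i, d i * a i : ℕ) : ℤ) ≤ ((D₀ * (N * a j) : ℕ) : ℤ) := by exact_mod_cast h2
    _ = (D₀ : ℤ) * ((N * a j : ℕ) : ℤ) := by push_cast; ring
    _ < G := (hG j).1

/-- **The coefficient of `ψ(T)` at the special exponent** `e⋆ = N Σ_i d_i a_i` of a monomial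
`d ≠ 0` of degree `≤ D₀` is `coeff d ψ`: by `split_unique` the only splitting with exponent `e⋆` is
the all-lower splitting `(d, d)` of `d` itself. -/
theorem coeff_aeval_special {m : ℕ} (D₀ : ℕ) (a b : Fin m → ℕ) (N M' : ℕ) (hN : 0 < N)
    (hP1 : ∀ u v : Fin m → ℤ, ∑ i, (|u i| + |v i|) ≤ 2 * (D₀ : ℤ) →
      ∑ i, (u i * (a i : ℤ) + v i * (b i : ℤ)) = 0 → (u, v) = 0)
    (hmod : ∀ i, a i % M' = 1 ∧ b i % M' = 1)
    (hlt : ∀ i j, D₀ * a i < M' * a j ∧ D₀ * a i < M' * b j ∧ D₀ * b i < M' * a j ∧ D₀ * b i < M' * b j)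
    (ψ : MvPolynomial (Fin m) ℂ) (d : Fin m →₀ ℕ) (hdD : ∑ i, d i ≤ D₀) (hd0 : d ≠ 0) :
    (MvPolynomial.aeval (fun i : Fin m => (HahnSeries.single ((N * a i : ℕ) : ℤ) (1 : ℂ) +
        HahnSeries.single ((N * b i : ℕ) : ℤ) (1 : ℂ) : LaurentSeries ℂ)) ψ).coeff
        ((N * ∑ i, d i * a i : ℕ) : ℤ) = MvPolynomial.coeff d ψ := by
  classical
  rw [LowDegreeVanishing.coeff_aeval_binomial]
  have hcond : ∀ (γ : Fin m →₀ ℕ) (s : Fin m → ℕ),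
      s ∈ Fintype.piFinset (fun i => range (γ i + 1)) →
      ((N * ∑ i, d i * a i : ℕ) : ℤ) =
        ∑ i, (s i • ((N * a i : ℕ) : ℤ) + (γ i - s i) • ((N * b i : ℕ) : ℤ)) →
      s = ⇑d ∧ ⇑γ = ⇑d := by
    intro γ s hs hex
    have hs' : ∀ i, s i ≤ γ i := fun i =>
      Nat.lt_succ_iff.mp (mem_range.mp (Fintype.mem_piFinset.mp hs i))
    rw [LowDegreeVanishing.exponent_cast, Nat.cast_inj] at hex
    exact split_unique D₀ a b M' hP1 hmod hlt (⇑d) hdD (fun h => hd0 (Finsupp.coe_eq_zero.mp h))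
      (⇑γ) s hs' (Nat.eq_of_mul_eq_mul_left hN hex).symm
  rw [sum_eq_single d ?_ ?_]
  · rw [sum_eq_single_of_mem (⇑d : Fin m → ℕ) ?_ ?_]
    · have hc : ((N * ∑ i, d i * a i : ℕ) : ℤ) =
          ∑ i, (d i • ((N * a i : ℕ) : ℤ) + (d i - d i) • ((N * b i : ℕ) : ℤ)) := by
        rw [LowDegreeVanishing.exponent_cast]
        simp
      rw [if_pos hc, prod_eq_one (fun i _ => by rw [Nat.choose_self, Nat.cast_one]), mul_one]
    · exact Fintype.mem_piFinset.mpr fun i => mem_range.mpr (Nat.lt_succ_self _)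
    · intro s hs hsd
      exact if_neg fun hex => hsd (hcond d s hs hex).1
  · intro γ _ hγd
    exact sum_eq_zero fun s hs => if_neg fun hex => hγd (DFunLike.coe_injective (hcond γ s hs hex).2)
  · intro h
    have h0 : MvPolynomial.coeff d ψ = 0 := by simpa [MvPolynomial.mem_support_iff] using h
    simp [h0]

end LowDegreeVanishingDeg

open LowDegreeVanishingDeg in
/-- **Helper `lowDegreeVanishing_deg`** (parametric uniqueness at degree `≤ D₀`; the case `D₀ = 2`
is `lowDegreeVanishing_zero`) of line `registered` (skeleton v3) of the crux
`BinomialElusive.BinomialCandidate`: under (P1) (no relation of length `≤ 2 D₀`) and (P2) (a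
congruence modulus `M'` with `D₀ e < M' e'` for all exponents), a polynomial `ψ` without constant
term with `ψ(T) ≡ 0 (mod t^G)` for `T_i = t^{N a_i} + t^{N b_i}` and `G > D₀ N a_i, D₀ N b_i` has
all coefficients of degree `≤ D₀` equal to zero.  (The hypothesis `1 ≤ D₀` is not used: for
`D₀ = 0` the only monomial of degree `≤ D₀` is the constant term.) -/
theorem lowDegreeVanishing_deg :
    ∀ (m D₀ : ℕ) (a b : Fin m → ℕ) (N : ℕ), 0 < N → 1 ≤ D₀ →
      (∀ u v : Fin m → ℤ, ∑ i, (|u i| + |v i|) ≤ 2 * (D₀ : ℤ) →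
        ∑ i, (u i * (a i : ℤ) + v i * (b i : ℤ)) = 0 → (u, v) = 0) →
      (∃ M' : ℕ, (∀ i, a i % M' = 1 ∧ b i % M' = 1) ∧
        (∀ i j, D₀ * a i < M' * a j ∧ D₀ * a i < M' * b j ∧ D₀ * b i < M' * a j ∧ D₀ * b i < M' * b j)) →
      ∀ (ψ : MvPolynomial (Fin m) ℂ) (G : ℤ), MvPolynomial.constantCoeff ψ = 0 →
        (∀ i, (D₀ : ℤ) * ((N * a i : ℕ) : ℤ) < G ∧ (D₀ : ℤ) * ((N * b i : ℕ) : ℤ) < G) →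
        (∀ g < G, (MvPolynomial.aeval (fun i : Fin m => (HahnSeries.single ((N * a i : ℕ) : ℤ) (1 : ℂ) +
            HahnSeries.single ((N * b i : ℕ) : ℤ) (1 : ℂ) : LaurentSeries ℂ)) ψ).coeff g = 0) →
        ∀ d : Fin m →₀ ℕ, (d.sum fun _ e => e) ≤ D₀ → MvPolynomial.coeff d ψ = 0 := by
  intro m D₀ a b N hN _ hP1 hP2 ψ G hcc hG hcong d hd
  obtain ⟨M', hmod, hlt⟩ := hP2
  by_cases hd0 : d = 0
  · subst hd0
    rw [MvPolynomial.constantCoeff_eq] at hcc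
    exact hcc
  have hdeg : ∑ i, d i ≤ D₀ := by rwa [Finsupp.sum_fintype _ _ (fun _ => rfl)] at hd
  -- an index in the support of `d` (only needed to make `Fin m` nonempty in `special_lt`)
  obtain ⟨i₀, -⟩ : ∃ i, d i ≠ 0 := by
    by_contra h
    push Not at h
    exact hd0 (Finsupp.ext h)
  have h1 := hcong _ (special_lt hG hdeg i₀)
  rwa [coeff_aeval_special D₀ a b N M' hN hP1 hmod hlt ψ d hdeg hd0] at h1

end Summit.ValiantsHypothesis.ValiantsHypothesis.Theorems.BinomialCandidateStubs
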